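import Summits.AnomalousDissipation.AnomalousDissipation.Theorems.SolenoidalFractalHomogenisationLagrangianStepZAssembly
import HarnessLib

/-!
# K1L_D (stmt-AnomalousDissipation-27980), line «onelevel-design»: the three (Zin) parts §9a/§9b/§9c of `stub_cellInputs` from ONE
# dissipation-weighted BILINEAR bound on the window error (helper; `--supports … --as helper`; lead-k1l-onelevel-p1 g4)

Split v29 (`Cruxes/LagrangianRenormalisationStep/Lines/onelevel_S23_split.lean`) cut the cell-side operator input (Zin) of `stub_cellInputs`
into §9a (slow block: diagonal + cross), §9b (leak into slow modes), §9c (fast low-label content), glued by `zin_of_parts`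
(`…CellInputsParts`, p673869).  All three are consequences of a SINGLE statement about the window-error operator `Z = U − T` on `V2`
(memo L7: by the propagator-level duality `…WindowDuality`, `⟪Z x, y⟫` is the time integral of the cross density between the true solution
from `x` and the coarse adjoint solution from `y`, so ONE bilinear estimate is the natural analytic target):

  (BIL)  `|⟪U x − T x, y⟫| ≤ η · N(x) · N(y)`,  `N(v)² = Σ_{k∈S} w_k ‖𝓕v(k)‖² + (‖v‖² − Σ_{k∈S} ‖𝓕v(k)‖²)`

for ALL `x, y ∈ V2` (`S` the slow-low Finset, symmetric; `w ≥ 0` the window weights `min(1, rate_k τ)`, symmetric and positive on `S`;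
`η > 0`).  THIS FILE (pure Hilbert-space/Fourier algebra on `V2`, no PDE):
* `slowBlock_of_bilinear` — §9a with `e_d := 0`, `e_c := PS(U PS u − T PS u)` (self-adjointness of the Fourier projector `PS`);
* `leak_of_bilinear` — §9b `Σ_S ‖𝓕(PS Z(u − PS u))(k)‖²/(η² w_k) ≤ ‖u‖² − Σ_S ‖𝓕u(k)‖²` (weighted `ℓ²(S)` duality: test (BIL) against the
  synthesised vector with coefficients `𝓕(Z(u − PS u))(k)/(η² w_k)` on `S`, `Torus.exists_forall_mFourierCoeff_eq_of_isConjSymm`);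
* `fast_of_bilinear` — §9c `‖P Z u − PS Z u‖ ≤ √(Σ_S η² w_k ‖𝓕u(k)‖²) + η √(‖u‖² − Σ_S ‖𝓕u(k)‖²)` (test (BIL) against `v = (P − PS) Z u` itself;
  `S ⊆ A`).
Tools: `…LabelSplit` (`fcoeff_sub`, Parseval `hasSum_norm_sq_fcoeff` / `hasSum_inner_fcoeff`), `…ZAssembly` (`norm_sq_eq_sum_of_support`,
`inner_eq_sum_of_support`, `sum_norm_sq_fcoeff_le`).  The §9-binder-level composition `(BIL text) → §9d → §9` rides in a companion file.
NOT a proof of any registered stub, of the crux, or of AD; rung F-D1.A0.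
-/

set_option linter.dupNamespace false  -- the summit-side namespace `Summit.AnomalousDissipation.AnomalousDissipation.…` repeats a component by design (D-0017)

noncomputable section

namespace Summit.AnomalousDissipation.AnomalousDissipation.Theorems.SolenoidalFractalHomogenisation.LagrangianStep

open Literature.Analysis Literature.Analysis.FunctionSpaces
open MeasureTheory Set Filter UnitAddTorus
open scoped ENNReal NNReal InnerProductSpace Classical
open OneLevelSplit

/-! ## Fourier-projector calculus on `V2` -/

section Proj

variable (S : Finset (Fin 3 → ℤ)) (PS : V2 →L[ℝ] V2)
  (hPS : ∀ (y : V2) (k : Fin 3 → ℤ), mFourierCoeff (EuclideanSpace.complexify ∘ ⇑(PS y)) k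
    = if k ∈ S then mFourierCoeff (EuclideanSpace.complexify ∘ ⇑y) k else 0)

/-- `𝓕(0) = 0` on `V2`. -/
theorem fcoeff_zero (k : Fin 3 → ℤ) : mFourierCoeff (EuclideanSpace.complexify ∘ ⇑(0 : V2)) k = 0 := by
  rw [show (0 : V2) = (0 : V2) - 0 from (sub_self _).symm, fcoeff_sub, sub_self]

include hPS

/-- The projector's output is supported on `S`. -/
theorem fcoeff_proj_of_not_mem (y : V2) {k : Fin 3 → ℤ} (hk : k ∉ S) :
    mFourierCoeff (EuclideanSpace.complexify ∘ ⇑(PS y)) k = 0 := by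
  rw [hPS, if_neg hk]

/-- `𝓕(y − PS y)(k) = if k ∈ S then 0 else 𝓕y(k)`. -/
theorem fcoeff_sub_proj (y : V2) (k : Fin 3 → ℤ) :
    mFourierCoeff (EuclideanSpace.complexify ∘ ⇑(y - PS y)) k
      = if k ∈ S then 0 else mFourierCoeff (EuclideanSpace.complexify ∘ ⇑y) k := by
  rw [fcoeff_sub, hPS]
  split_ifs <;> simp

/-- `‖PS y‖² = Σ_S ‖𝓕y(k)‖²`. -/
theorem norm_sq_proj (y : V2) :
    ‖PS y‖ ^ 2 = ∑ k ∈ S, ‖mFourierCoeff (EuclideanSpace.complexify ∘ ⇑y) k‖ ^ 2 := by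
  rw [norm_sq_eq_sum_of_support S (PS y) (fun k hk => fcoeff_proj_of_not_mem S PS hPS y hk)]
  exact Finset.sum_congr rfl fun k hk => by rw [hPS, if_pos hk]

/-- `‖y − PS y‖² = ‖y‖² − Σ_S ‖𝓕y(k)‖²`. -/
theorem norm_sq_sub_proj (y : V2) :
    ‖y - PS y‖ ^ 2 = ‖y‖ ^ 2 - ∑ k ∈ S, ‖mFourierCoeff (EuclideanSpace.complexify ∘ ⇑y) k‖ ^ 2 := by
  have h3 : ⟪y - PS y, PS y⟫_ℝ = 0 := by
    refine inner_eq_zero_of_disjoint_fcoeff fun k => ?_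
    by_cases hk : k ∈ S
    · left; rw [fcoeff_sub_proj S PS hPS, if_pos hk]
    · right; exact fcoeff_proj_of_not_mem S PS hPS y hk
  have e : y = (y - PS y) + PS y := by abel
  have h := norm_add_sq_real (y - PS y) (PS y)
  rw [← e, h3, norm_sq_proj S PS hPS] at h
  linarith

/-- The Fourier projector is symmetric: `⟪y, PS z⟫ = ⟪PS y, z⟫`. -/
theorem inner_proj_right_eq_inner_proj_left (y z : V2) : ⟪y, PS z⟫_ℝ = ⟪PS y, z⟫_ℝ := by
  rw [inner_eq_sum_of_support S y (PS z) (fun k hk => fcoeff_proj_of_not_mem S PS hPS z hk), real_inner_comm,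
    inner_eq_sum_of_support S z (PS y) (fun k hk => fcoeff_proj_of_not_mem S PS hPS y hk)]
  refine Finset.sum_congr rfl fun k hk => ?_
  rw [hPS, hPS, if_pos hk, if_pos hk, ← inner_conj_symm, Complex.conj_re]

/-- The weighted slow energy of `PS y` is that of `y`. -/
theorem sum_weight_proj (w : (Fin 3 → ℤ) → ℝ) (y : V2) :
    ∑ k ∈ S, w k * ‖mFourierCoeff (EuclideanSpace.complexify ∘ ⇑(PS y)) k‖ ^ 2
      = ∑ k ∈ S, w k * ‖mFourierCoeff (EuclideanSpace.complexify ∘ ⇑y) k‖ ^ 2 :=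
  Finset.sum_congr rfl fun k hk => by rw [hPS, if_pos hk]

/-- `PS y` has no non-slow energy: `‖PS y‖² − Σ_S ‖𝓕(PS y)(k)‖² = 0`. -/
theorem rest_proj (y : V2) :
    ‖PS y‖ ^ 2 - ∑ k ∈ S, ‖mFourierCoeff (EuclideanSpace.complexify ∘ ⇑(PS y)) k‖ ^ 2 = 0 := by
  rw [norm_sq_eq_sum_of_support S (PS y) (fun k hk => fcoeff_proj_of_not_mem S PS hPS y hk), sub_self]

end Proj

/-! ## Two scalar facts -/

/-- `√(a + b) ≤ √a + √b`. -/
theorem sqrt_add_le' (a b : ℝ) : Real.sqrt (a + b) ≤ Real.sqrt a + Real.sqrt b := by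
  rcases le_or_gt 0 a with ha | ha
  · rcases le_or_gt 0 b with hb | hb
    · have h : a + b ≤ (Real.sqrt a + Real.sqrt b) ^ 2 := by
        rw [add_sq, Real.sq_sqrt ha, Real.sq_sqrt hb]
        nlinarith [Real.sqrt_nonneg a, Real.sqrt_nonneg b]
      calc Real.sqrt (a + b) ≤ Real.sqrt ((Real.sqrt a + Real.sqrt b) ^ 2) := Real.sqrt_le_sqrt h
        _ = Real.sqrt a + Real.sqrt b := Real.sqrt_sq (add_nonneg (Real.sqrt_nonneg a) (Real.sqrt_nonneg b))
    · have h1 : Real.sqrt (a + b) ≤ Real.sqrt a := Real.sqrt_le_sqrt (by linarith)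
      linarith [Real.sqrt_nonneg b]
  · have h1 : Real.sqrt (a + b) ≤ Real.sqrt b := Real.sqrt_le_sqrt (by linarith)
    linarith [Real.sqrt_nonneg a]

/-- Absorption: `r² ≤ c·r` with `0 ≤ c` gives `r ≤ c` for `r ≥ 0`… in the form `Λ ≤ c √Λ ⇒ Λ ≤ c²` (`Λ ≥ 0`, `c ≥ 0`). -/
theorem le_sq_of_le_mul_sqrt {Λ c : ℝ} (hΛ : 0 ≤ Λ) (hc : 0 ≤ c) (h : Λ ≤ c * Real.sqrt Λ) : Λ ≤ c ^ 2 := by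
  have hr : 0 ≤ Real.sqrt Λ := Real.sqrt_nonneg Λ
  have hsq : Real.sqrt Λ ^ 2 = Λ := Real.sq_sqrt hΛ
  by_cases h0 : Real.sqrt Λ = 0
  · have : Λ = 0 := by rw [← hsq, h0]; ring
    rw [this]; positivity
  · have hpos : 0 < Real.sqrt Λ := lt_of_le_of_ne hr (Ne.symm h0)
    have h1 : Real.sqrt Λ * Real.sqrt Λ ≤ c * Real.sqrt Λ := by nlinarith
    have h2 : Real.sqrt Λ ≤ c := le_of_mul_le_mul_right h1 hpos
    nlinarith

/-! ## The three (Zin) parts from the bilinear bound -/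

section Parts

variable (S : Finset (Fin 3 → ℤ)) (hS : ∀ k, k ∈ S ↔ -k ∈ S) (T U PS : V2 →L[ℝ] V2) (w : (Fin 3 → ℤ) → ℝ) (η : ℝ)
  (hPS : ∀ (y : V2) (k : Fin 3 → ℤ), mFourierCoeff (EuclideanSpace.complexify ∘ ⇑(PS y)) k
    = if k ∈ S then mFourierCoeff (EuclideanSpace.complexify ∘ ⇑y) k else 0)
  (hw0 : ∀ k, 0 ≤ w k) (hη : 0 < η)
  (hbil : ∀ x y : V2, |⟪U x - T x, y⟫_ℝ| ≤ η
    * Real.sqrt (∑ k ∈ S, w k * ‖mFourierCoeff (EuclideanSpace.complexify ∘ ⇑x) k‖ ^ 2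
        + (‖x‖ ^ 2 - ∑ k ∈ S, ‖mFourierCoeff (EuclideanSpace.complexify ∘ ⇑x) k‖ ^ 2))
    * Real.sqrt (∑ k ∈ S, w k * ‖mFourierCoeff (EuclideanSpace.complexify ∘ ⇑y) k‖ ^ 2
        + (‖y‖ ^ 2 - ∑ k ∈ S, ‖mFourierCoeff (EuclideanSpace.complexify ∘ ⇑y) k‖ ^ 2)))

include hPS hw0 hη hbil

/-- **§9a from (BIL).**  Slow block `PS(U PS u − T PS u) = e_d + e_c` with `e_d := 0` (trivially supported on `S` and diagonally small) and the
cross part `e_c := PS(U PS u − T PS u)` obeying the dissipation-weighted Cauchy–Schwarz bound (symmetry of `PS`, (BIL) at `(PS u, PS y)`). -/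
theorem slowBlock_of_bilinear (u : V2) :
    ∃ e_d e_c : V2,
      PS (U (PS u) - T (PS u)) = e_d + e_c ∧
      (∀ k, k ∉ S → mFourierCoeff (EuclideanSpace.complexify ∘ ⇑e_d) k = 0) ∧
      (∀ k, k ∈ S → ‖mFourierCoeff (EuclideanSpace.complexify ∘ ⇑e_d) k‖
        ≤ η * w k * ‖mFourierCoeff (EuclideanSpace.complexify ∘ ⇑u) k‖) ∧
      (∀ y : V2, |⟪y, e_c⟫_ℝ| ≤ η
        * Real.sqrt (∑ k ∈ S, w k * ‖mFourierCoeff (EuclideanSpace.complexify ∘ ⇑u) k‖ ^ 2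
            + (‖u‖ ^ 2 - ∑ k ∈ S, ‖mFourierCoeff (EuclideanSpace.complexify ∘ ⇑u) k‖ ^ 2))
        * Real.sqrt (∑ k ∈ S, w k * ‖mFourierCoeff (EuclideanSpace.complexify ∘ ⇑y) k‖ ^ 2
            + (‖y‖ ^ 2 - ∑ k ∈ S, ‖mFourierCoeff (EuclideanSpace.complexify ∘ ⇑y) k‖ ^ 2))) := by
  refine ⟨0, PS (U (PS u) - T (PS u)), by rw [zero_add], fun k _ => fcoeff_zero k, ?_, ?_⟩
  · intro k _
    rw [fcoeff_zero, norm_zero]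
    exact mul_nonneg (mul_nonneg hη.le (hw0 k)) (norm_nonneg _)
  · intro y
    rw [inner_proj_right_eq_inner_proj_left S PS hPS, real_inner_comm]
    refine (hbil (PS u) (PS y)).trans ?_
    rw [sum_weight_proj S PS hPS, sum_weight_proj S PS hPS, rest_proj S PS hPS, rest_proj S PS hPS, add_zero, add_zero]
    have hru : 0 ≤ ‖u‖ ^ 2 - ∑ k ∈ S, ‖mFourierCoeff (EuclideanSpace.complexify ∘ ⇑u) k‖ ^ 2 :=
      sub_nonneg.2 (sum_norm_sq_fcoeff_le S u)
    have hry : 0 ≤ ‖y‖ ^ 2 - ∑ k ∈ S, ‖mFourierCoeff (EuclideanSpace.complexify ∘ ⇑y) k‖ ^ 2 :=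
      sub_nonneg.2 (sum_norm_sq_fcoeff_le S y)
    have h1 : Real.sqrt (∑ k ∈ S, w k * ‖mFourierCoeff (EuclideanSpace.complexify ∘ ⇑u) k‖ ^ 2)
        ≤ Real.sqrt (∑ k ∈ S, w k * ‖mFourierCoeff (EuclideanSpace.complexify ∘ ⇑u) k‖ ^ 2
            + (‖u‖ ^ 2 - ∑ k ∈ S, ‖mFourierCoeff (EuclideanSpace.complexify ∘ ⇑u) k‖ ^ 2)) :=
      Real.sqrt_le_sqrt (by linarith)
    have h2 : Real.sqrt (∑ k ∈ S, w k * ‖mFourierCoeff (EuclideanSpace.complexify ∘ ⇑y) k‖ ^ 2)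
        ≤ Real.sqrt (∑ k ∈ S, w k * ‖mFourierCoeff (EuclideanSpace.complexify ∘ ⇑y) k‖ ^ 2
            + (‖y‖ ^ 2 - ∑ k ∈ S, ‖mFourierCoeff (EuclideanSpace.complexify ∘ ⇑y) k‖ ^ 2)) :=
      Real.sqrt_le_sqrt (by linarith)
    exact mul_le_mul (mul_le_mul_of_nonneg_left h1 hη.le) h2 (Real.sqrt_nonneg _)
      (mul_nonneg hη.le (Real.sqrt_nonneg _))

omit hw0 in
/-- **§9b from (BIL).**  The leak of the non-slow content into the slow modes is small in the weighted `ℓ²(S)` norm dual to `N`: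
`Σ_S ‖𝓕(PS(U(u − PS u) − T(u − PS u)))(k)‖²/(η² w_k) ≤ ‖u‖² − Σ_S ‖𝓕u(k)‖²` (weights symmetric and positive on `S`). -/
theorem leak_of_bilinear (hS : ∀ k, k ∈ S ↔ -k ∈ S) (hwS : ∀ k, k ∈ S → 0 < w k) (hwsymm : ∀ k, w (-k) = w k) (u : V2) :
    ∑ k ∈ S, ‖mFourierCoeff (EuclideanSpace.complexify ∘ ⇑(PS (U (u - PS u) - T (u - PS u)))) k‖ ^ 2 / (η ^ 2 * w k)
      ≤ ‖u‖ ^ 2 - ∑ k ∈ S, ‖mFourierCoeff (EuclideanSpace.complexify ∘ ⇑u) k‖ ^ 2 := by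
  -- the coefficients of the window error of the non-slow content
  set a : (Fin 3 → ℤ) → EuclideanSpace ℂ (Fin 3) :=
    fun k => mFourierCoeff (EuclideanSpace.complexify ∘ ⇑(U (u - PS u) - T (u - PS u))) k with ha
  set Λ : ℝ := ∑ k ∈ S, ‖a k‖ ^ 2 / (η ^ 2 * w k) with hΛ
  have hΛ0 : 0 ≤ Λ := Finset.sum_nonneg fun k hk => div_nonneg (sq_nonneg _) (mul_pos (pow_pos hη 2) (hwS k hk)).le
  -- the LHS is `Λ`
  have hL : ∑ k ∈ S, ‖mFourierCoeff (EuclideanSpace.complexify ∘ ⇑(PS (U (u - PS u) - T (u - PS u)))) k‖ ^ 2 / (η ^ 2 * w k) = Λ :=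
    Finset.sum_congr rfl fun k hk => by rw [hPS, if_pos hk]
  -- the RHS is `‖u − PS u‖²`
  have hR : ‖u - PS u‖ ^ 2 = ‖u‖ ^ 2 - ∑ k ∈ S, ‖mFourierCoeff (EuclideanSpace.complexify ∘ ⇑u) k‖ ^ 2 :=
    norm_sq_sub_proj S PS hPS u
  rw [hL, ← hR]
  -- the synthesised test vector: coefficients `a k / (η² w k)` on `S`
  set c : (Fin 3 → ℤ) → EuclideanSpace ℂ (Fin 3) := fun k => if k ∈ S then (1 / (η ^ 2 * w k)) • a k else 0 with hc
  have hsymm : Torus.IsConjSymm c := by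
    intro k
    have hak : a (-k) = EuclideanSpace.conjVec (a k) := Torus.isConjSymm_mFourierCoeff (integrable_coe_V2 _) k
    by_cases hk : k ∈ S
    · have hk' : -k ∈ S := (hS k).1 hk
      simp only [hc, hk, hk', if_true, hwsymm, hak, EuclideanSpace.conjVec_real_smul]
    · have hk' : -k ∉ S := fun h => hk (by simpa using (hS (-k)).1 h)
      simp only [hc, hk, hk', if_false]
      ext i; simp
  have hc0 : ∀ k, k ∉ S → c k = 0 := fun k hk => by simp only [hc, hk, if_false]
  have hsum : Summable (fun k => ‖c k‖ ^ 2) :=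
    summable_of_ne_finset_zero (s := S) fun k hk => by rw [hc0 k hk, norm_zero]; ring
  obtain ⟨y, hy⟩ := FluidPDE.Torus.exists_forall_mFourierCoeff_eq_of_isConjSymm hsymm hsum
  have hy0 : ∀ k, k ∉ S → mFourierCoeff (EuclideanSpace.complexify ∘ ⇑y) k = 0 := fun k hk => by rw [hy, hc0 k hk]
  -- norm of a coefficient of the test vector
  have hcn : ∀ k, k ∈ S → ‖c k‖ ^ 2 = ‖a k‖ ^ 2 / (η ^ 2 * w k) ^ 2 := by
    intro k hk
    have hpos : 0 < η ^ 2 * w k := mul_pos (pow_pos hη 2) (hwS k hk)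
    simp only [hc, hk, if_true]
    rw [norm_smul, Real.norm_eq_abs, abs_of_pos (one_div_pos.2 hpos), mul_pow]
    field_simp
  -- `⟪Z x', y⟫ = Λ`
  have hpair : ⟪U (u - PS u) - T (u - PS u), y⟫_ℝ = Λ := by
    rw [inner_eq_sum_of_support S _ y hy0, hΛ]
    refine Finset.sum_congr rfl fun k hk => ?_
    rw [hy]
    simp only [hc, hk, if_true]
    show (inner ℂ (a k) ((1 / (η ^ 2 * w k)) • a k)).re = ‖a k‖ ^ 2 / (η ^ 2 * w k)
    rw [← Complex.coe_smul, inner_smul_right]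
    have e2 : (inner ℂ (a k) (a k)).re = ‖a k‖ ^ 2 := by simpa using inner_self_eq_norm_sq (𝕜 := ℂ) (a k)
    rw [Complex.mul_re, e2, Complex.ofReal_re, Complex.ofReal_im, zero_mul, sub_zero]
    field_simp
  -- `N(x') = ‖x'‖`
  have hNx : Real.sqrt (∑ k ∈ S, w k * ‖mFourierCoeff (EuclideanSpace.complexify ∘ ⇑(u - PS u)) k‖ ^ 2
      + (‖u - PS u‖ ^ 2 - ∑ k ∈ S, ‖mFourierCoeff (EuclideanSpace.complexify ∘ ⇑(u - PS u)) k‖ ^ 2)) = ‖u - PS u‖ := by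
    have h1 : ∑ k ∈ S, w k * ‖mFourierCoeff (EuclideanSpace.complexify ∘ ⇑(u - PS u)) k‖ ^ 2 = 0 :=
      Finset.sum_eq_zero fun k hk => by rw [fcoeff_sub_proj S PS hPS, if_pos hk, norm_zero]; ring
    have h2 : ∑ k ∈ S, ‖mFourierCoeff (EuclideanSpace.complexify ∘ ⇑(u - PS u)) k‖ ^ 2 = 0 :=
      Finset.sum_eq_zero fun k hk => by rw [fcoeff_sub_proj S PS hPS, if_pos hk, norm_zero]; ring
    rw [h1, h2, sub_zero, zero_add, Real.sqrt_sq (norm_nonneg _)]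
  -- `N(y)² = Λ / η²`
  have hNy : ∑ k ∈ S, w k * ‖mFourierCoeff (EuclideanSpace.complexify ∘ ⇑y) k‖ ^ 2
      + (‖y‖ ^ 2 - ∑ k ∈ S, ‖mFourierCoeff (EuclideanSpace.complexify ∘ ⇑y) k‖ ^ 2) = Λ / η ^ 2 := by
    rw [norm_sq_eq_sum_of_support S y hy0, sub_self, add_zero, hΛ, Finset.sum_div]
    refine Finset.sum_congr rfl fun k hk => ?_
    have hwk : 0 < w k := hwS k hk
    rw [hy, hcn k hk]
    field_simp
  -- (BIL) at `(x', y)`: `Λ ≤ ‖x'‖ √Λ`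
  have key := hbil (u - PS u) y
  rw [hpair, hNx, hNy, abs_of_nonneg hΛ0, Real.sqrt_div' Λ (pow_nonneg hη.le 2), Real.sqrt_sq hη.le] at key
  have key' : Λ ≤ ‖u - PS u‖ * Real.sqrt Λ := by
    have e : η * ‖u - PS u‖ * (Real.sqrt Λ / η) = ‖u - PS u‖ * Real.sqrt Λ := by
      field_simp
    rwa [e] at key
  exact le_sq_of_le_mul_sqrt hΛ0 (norm_nonneg _) key'

omit hw0 in
/-- **§9c from (BIL).**  The fast-frequency / low-label part `v = P Z u − PS Z u` of the window error `Z u = U u − T u` (`S ⊆ A`) satisfies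
`‖v‖² = ⟪Z u, v⟫ ≤ η N(u) ‖v‖`, hence `‖v‖ ≤ √(Σ_S η² w_k ‖𝓕u(k)‖²) + η √(‖u‖² − Σ_S ‖𝓕u(k)‖²)`. -/
theorem fast_of_bilinear {A : Set (Fin 3 → ℤ)} (hSA : ∀ k, k ∈ S → k ∈ A) (P : V2 →L[ℝ] V2)
    (hP : ∀ (y : V2) (k : Fin 3 → ℤ), mFourierCoeff (EuclideanSpace.complexify ∘ ⇑(P y)) k
      = if k ∈ A then mFourierCoeff (EuclideanSpace.complexify ∘ ⇑y) k else 0) (u : V2) :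
    ‖P (U u - T u) - PS (U u - T u)‖
      ≤ Real.sqrt (∑ k ∈ S, η ^ 2 * w k * ‖mFourierCoeff (EuclideanSpace.complexify ∘ ⇑u) k‖ ^ 2)
        + η * Real.sqrt (‖u‖ ^ 2 - ∑ k ∈ S, ‖mFourierCoeff (EuclideanSpace.complexify ∘ ⇑u) k‖ ^ 2) := by
  -- coefficients of `v`
  have hv : ∀ k, mFourierCoeff (EuclideanSpace.complexify ∘ ⇑(P (U u - T u) - PS (U u - T u))) k
      = if k ∈ A ∧ k ∉ S then mFourierCoeff (EuclideanSpace.complexify ∘ ⇑(U u - T u)) k else 0 := by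
    intro k
    rw [fcoeff_sub, hP, hPS]
    by_cases hkS : k ∈ S
    · simp [hkS, hSA k hkS]
    · by_cases hkA : k ∈ A
      · simp [hkS, hkA]
      · simp [hkS, hkA]
  have hvS : ∀ k, k ∈ S → mFourierCoeff (EuclideanSpace.complexify ∘ ⇑(P (U u - T u) - PS (U u - T u))) k = 0 := by
    intro k hk; rw [hv]; simp [hk]
  -- `‖v‖² = ⟪Z u, v⟫`
  have hsq : ‖P (U u - T u) - PS (U u - T u)‖ ^ 2 = ⟪U u - T u, P (U u - T u) - PS (U u - T u)⟫_ℝ := by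
    have h1 := hasSum_inner_fcoeff (U u - T u) (P (U u - T u) - PS (U u - T u))
    have h2 := hasSum_inner_fcoeff (P (U u - T u) - PS (U u - T u)) (P (U u - T u) - PS (U u - T u))
    have e : (fun k : Fin 3 → ℤ => (inner ℂ (mFourierCoeff (EuclideanSpace.complexify ∘ ⇑(U u - T u)) k)
        (mFourierCoeff (EuclideanSpace.complexify ∘ ⇑(P (U u - T u) - PS (U u - T u))) k)).re)
        = fun k => (inner ℂ (mFourierCoeff (EuclideanSpace.complexify ∘ ⇑(P (U u - T u) - PS (U u - T u))) k)
          (mFourierCoeff (EuclideanSpace.complexify ∘ ⇑(P (U u - T u) - PS (U u - T u))) k)).re := by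
      funext k
      rw [hv k]
      split_ifs <;> simp
    rw [e] at h1
    rw [← real_inner_self_eq_norm_sq, h1.unique h2]
  -- (BIL) at `(u, v)`
  have key := hbil u (P (U u - T u) - PS (U u - T u))
  have hD : ∑ k ∈ S, w k * ‖mFourierCoeff (EuclideanSpace.complexify ∘ ⇑(P (U u - T u) - PS (U u - T u))) k‖ ^ 2 = 0 :=
    Finset.sum_eq_zero fun k hk => by rw [hvS k hk, norm_zero]; ring
  have hR : ∑ k ∈ S, ‖mFourierCoeff (EuclideanSpace.complexify ∘ ⇑(P (U u - T u) - PS (U u - T u))) k‖ ^ 2 = 0 :=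
    Finset.sum_eq_zero fun k hk => by rw [hvS k hk, norm_zero]; ring
  rw [hD, hR, sub_zero, zero_add, Real.sqrt_sq (norm_nonneg _), ← hsq, abs_of_nonneg (sq_nonneg _)] at key
  -- absorb one factor `‖v‖`
  have hN : 0 ≤ η * Real.sqrt (∑ k ∈ S, w k * ‖mFourierCoeff (EuclideanSpace.complexify ∘ ⇑u) k‖ ^ 2
      + (‖u‖ ^ 2 - ∑ k ∈ S, ‖mFourierCoeff (EuclideanSpace.complexify ∘ ⇑u) k‖ ^ 2)) := mul_nonneg hη.le (Real.sqrt_nonneg _)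
  have h1 : ‖P (U u - T u) - PS (U u - T u)‖
      ≤ η * Real.sqrt (∑ k ∈ S, w k * ‖mFourierCoeff (EuclideanSpace.complexify ∘ ⇑u) k‖ ^ 2
          + (‖u‖ ^ 2 - ∑ k ∈ S, ‖mFourierCoeff (EuclideanSpace.complexify ∘ ⇑u) k‖ ^ 2)) := by
    by_cases h0 : ‖P (U u - T u) - PS (U u - T u)‖ = 0
    · rw [h0]; exact hN
    · have hpos : 0 < ‖P (U u - T u) - PS (U u - T u)‖ := lt_of_le_of_ne (norm_nonneg _) (Ne.symm h0)
      rw [pow_two] at key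
      have key' : ‖P (U u - T u) - PS (U u - T u)‖ * ‖P (U u - T u) - PS (U u - T u)‖
          ≤ η * Real.sqrt (∑ k ∈ S, w k * ‖mFourierCoeff (EuclideanSpace.complexify ∘ ⇑u) k‖ ^ 2
              + (‖u‖ ^ 2 - ∑ k ∈ S, ‖mFourierCoeff (EuclideanSpace.complexify ∘ ⇑u) k‖ ^ 2))
            * ‖P (U u - T u) - PS (U u - T u)‖ := by linarith
      exact le_of_mul_le_mul_right key' hpos
  -- split the square root
  refine h1.trans ?_
  have hsplit := sqrt_add_le' (∑ k ∈ S, w k * ‖mFourierCoeff (EuclideanSpace.complexify ∘ ⇑u) k‖ ^ 2)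
    (‖u‖ ^ 2 - ∑ k ∈ S, ‖mFourierCoeff (EuclideanSpace.complexify ∘ ⇑u) k‖ ^ 2)
  have e : Real.sqrt (∑ k ∈ S, η ^ 2 * w k * ‖mFourierCoeff (EuclideanSpace.complexify ∘ ⇑u) k‖ ^ 2)
      = η * Real.sqrt (∑ k ∈ S, w k * ‖mFourierCoeff (EuclideanSpace.complexify ∘ ⇑u) k‖ ^ 2) := by
    have : ∑ k ∈ S, η ^ 2 * w k * ‖mFourierCoeff (EuclideanSpace.complexify ∘ ⇑u) k‖ ^ 2
        = η ^ 2 * ∑ k ∈ S, w k * ‖mFourierCoeff (EuclideanSpace.complexify ∘ ⇑u) k‖ ^ 2 := by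
      rw [Finset.mul_sum]; exact Finset.sum_congr rfl fun k _ => by ring
    rw [this, Real.sqrt_mul (pow_nonneg hη.le 2), Real.sqrt_sq hη.le]
  rw [e]
  nlinarith [hη]

end Parts

end Summit.AnomalousDissipation.AnomalousDissipation.Theorems.SolenoidalFractalHomogenisation.LagrangianStep

end
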